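import Mathlib
import HarnessLib

/-!
# Crux `Persistence` (stmt-ResolutionOfSingularities-16484), chain W4.4b — K-C3 K4e, generic half:
# a quotient `F ⧸ N` is projective when `N` is spanned by vectors with a CLEAN PIVOT SYSTEM

Route `ResolutionOfSingularities/HomologicalConductor`.  OURS (cell res-hironaka, crux chain W4.4b, K-C3
K4e «`X_b` is a lattice over `P₀ = k[a⁶,b³,c²]`», CHAIN v13.5 §V13.13; res-D-pv-037 K4e-NOTE (a)/(b);
seat res-D-pv-058); nothing here is a statement of the manuscript under review (Hironaka 2017);
AI-written, weaker than expert review.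

The device that turns the MCM-ness of the K-C3 witness `X_b = W₀⁸ ⧸ ∂ W₀¹²` into a finite certificate.
`P` a commutative ring, `F` a projective `P`-module, `w₁, …, wₙ ∈ F` and a `P`-linear
`π : F → Pⁿ` with `π(wᵢ) = eᵢ` (a CLEAN PIVOT SYSTEM: `n` coordinates reading off the coefficients).
Then `s : Pⁿ → F`, `y ↦ Σ yᵢ wᵢ`, is a section of `π` with image `N = span{wᵢ}`, `id − s ∘ π` kills
`N` and descends to a splitting `F ⧸ N → F` of the projection, so `F ⧸ N` is a retract of `F`:

* `projective_quotient_of_pivots` — `Module.Projective P (F ⧸ span P {wᵢ})`;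
* `projective_quotient_restrictScalars_of_pivots` — the same for `F ⧸ N` with `N` an `R`-submodule
  (`R` a `P`-algebra acting on `F` compatibly) whose restriction of scalars is `span P {wᵢ}` — the shape
  of the K-C3 instance (`R = W₀`, `P = P₀`, `F = W₀⁸`, `N = ∂ W₀¹²`, `n = 18`).
[OURS; elementary linear algebra.]
-/

-- single-problem summit: the doubled namespace component `ResolutionOfSingularities` is forced
set_option linter.dupNamespace false

universe u v w

namespace Summit.ResolutionOfSingularities.ResolutionOfSingularities.Theorems.HomologicalConductor.PersistenceCleanPivots

variable {P : Type u} [CommRing P] {F : Type v} [AddCommGroup F] [Module P F] {n : ℕ}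

/-- The combination map `s : Pⁿ → F`, `y ↦ Σ yᵢ • wᵢ`, is a section of a clean pivot reading `π`:
`π ∘ s = id`. [folklore] -/
theorem pivot_comp_linearCombination (w : Fin n → F) (π : F →ₗ[P] (Fin n → P))
    (hπ : ∀ i, π (w i) = Pi.single i 1) :
    π ∘ₗ Fintype.linearCombination P w = LinearMap.id := by
  refine (Pi.basisFun P (Fin n)).ext fun i => ?_
  rw [LinearMap.comp_apply, Pi.basisFun_apply, Fintype.linearCombination_apply_single, one_smul, hπ,
    LinearMap.id_apply]

/-- **Projectivity from a clean pivot system.**  `F` a projective `P`-module, `w : Fin n → F`,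
`π : F →ₗ[P] (Fin n → P)` with `π (w i) = Pi.single i 1`.  Then `F ⧸ span P {wᵢ}` is projective: the map
`id − s ∘ π` (`s y = Σ yᵢ wᵢ`) vanishes on `span {wᵢ} = range s` and descends to a right inverse of the
projection `F → F ⧸ span {wᵢ}`, exhibiting the quotient as a retract of `F`. [folklore] -/
theorem projective_quotient_of_pivots [Module.Projective P F] (w : Fin n → F)
    (π : F →ₗ[P] (Fin n → P)) (hπ : ∀ i, π (w i) = Pi.single i 1) :
    Module.Projective P (F ⧸ Submodule.span P (Set.range w)) := by
  set N : Submodule P F := Submodule.span P (Set.range w) with hNdef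
  have hrange : LinearMap.range (Fintype.linearCombination P w) = N := by
    rw [hNdef, Fintype.range_linearCombination]
  have hsec := pivot_comp_linearCombination w π hπ
  -- `t = id - s ∘ π` kills `N`
  set t : F →ₗ[P] F := LinearMap.id - Fintype.linearCombination P w ∘ₗ π with htdef
  have hker : N ≤ LinearMap.ker t := by
    rw [← hrange]
    rintro _ ⟨y, rfl⟩
    rw [LinearMap.mem_ker, htdef, LinearMap.sub_apply, LinearMap.id_apply, LinearMap.comp_apply,
      ← LinearMap.comp_apply π, hsec, LinearMap.id_apply, sub_self]
  -- the induced splitting of the projection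
  refine Module.Projective.of_split (N.liftQ t hker) N.mkQ ?_
  refine Submodule.linearMap_qext N ?_
  rw [LinearMap.comp_assoc, Submodule.liftQ_mkQ, LinearMap.id_comp]
  refine LinearMap.ext fun x => ?_
  rw [LinearMap.comp_apply, htdef, LinearMap.sub_apply, map_sub, LinearMap.id_apply, sub_eq_self,
    Submodule.mkQ_apply, Submodule.Quotient.mk_eq_zero, ← hrange]
  exact LinearMap.mem_range_self _ _

/-- **Projectivity from a clean pivot system, tower form.**  `R` a `P`-algebra, `F` an `R`-module with
compatible `P`-action, projective over `P`; `N` an `R`-submodule of `F` whose restriction of scalars to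
`P` is `span P {wᵢ}` for a clean pivot system `(w, π)` over `P`.  Then `F ⧸ N` is a projective `P`-module
(for the `P`-module structure inherited through the tower). [folklore] -/
theorem projective_quotient_restrictScalars_of_pivots {R : Type w} [Ring R] [Algebra P R] [Module R F]
    [IsScalarTower P R F] [Module.Projective P F] (N : Submodule R F) (w : Fin n → F)
    (π : F →ₗ[P] (Fin n → P)) (hπ : ∀ i, π (w i) = Pi.single i 1)
    (hN : N.restrictScalars P = Submodule.span P (Set.range w)) :
    Module.Projective P (F ⧸ N) := by
  haveI : Module.Projective P (F ⧸ N.restrictScalars P) := by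
    rw [hN]
    exact projective_quotient_of_pivots w π hπ
  exact Module.Projective.of_equiv (Submodule.Quotient.restrictScalarsEquiv P N)

end Summit.ResolutionOfSingularities.ResolutionOfSingularities.Theorems.HomologicalConductor.PersistenceCleanPivots
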